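import Mathlib.GroupTheory.GroupAction.Quotient
import Mathlib.GroupTheory.GroupAction.SubMulAction
import Mathlib.GroupTheory.GroupAction.CardCommute
import Mathlib.GroupTheory.GroupAction.ConjAct
import Mathlib.GroupTheory.Index
import Mathlib.Data.Set.Card
import Literature.NumberTheory.GaloisRepresentations.ProjectiveTypeSolvable
import HarnessLib

/-!
# Klein's classification from two axioms (abstract finite group theory)

Trunk GalRep (topic `NumberTheory/GaloisRepresentations`), companion to `ProjectiveType` and
`ProjectiveTypeSolvable`, serving the discharge of the named fact
`Literature.NumberTheory.GaloisRepresentations.klein_finite_subgroup_pgl_two` (Klein 1884;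
Getz–Hahn, GTM 300 (2024), Thm. 13.4.4: a finite subgroup of `PGL_2(ℂ)` is cyclic, dihedral,
`A_4`, `S_4` or `A_5`) in `ProjectiveTypeProofs`.

This file contains the **group-theoretic half** of the classical proof (Klein, *Vorlesungen
über das Ikosaeder* (1884), I §§1–2; the "pole counting" argument found in every textbook
treatment of the finite rotation groups), axiomatised so that no matrices appear: let a finite
group `H` act on a set `X` such that

* (`HasTwoFixedPoints`) every `h ≠ 1` has exactly two fixed points, and
* every stabiliser is cyclic.

Then `H` is cyclic, or isomorphic to a dihedral group `DihedralGroup m`, or to `A_4`, `S_4` or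
`A_5` (`klein_of_hasTwoFixedPoints`).  The geometric half — that a finite subgroup of
`PGL_2(k)`, `k` algebraically closed of characteristic `0`, acting on `ℙ¹(k)` satisfies the two
axioms — is in `ProjectiveTypeProofs`.

## The proof

* **Poles and Burnside** (`poles`, `burnside`, `signature`).  A *pole* is a point with
  non-trivial stabiliser; the poles form a finite `H`-stable set `Ω`.  Burnside's lemma on
  `Ω` gives `|Ω| + 2(|H| - 1) = r |H|` (`r` orbits), the class formula gives
  `|Ω| = ∑ᵢ |H|/nᵢ` (`nᵢ ≥ 2` the stabiliser orders), and the diophantine analysis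
  (`arith_three`) leaves: `H = 1`; a point fixed by `H` (`r = 2`); a stabiliser of index `2`
  (signature `(2,2,n)`); or `|H| = 12, 24, 60` with stabiliser orders in `{2,3}`, `{2,3,4}`,
  `{2,3,5}` (signatures `(2,3,3)`, `(2,3,4)`, `(2,3,5)`).
* **Cyclic / dihedral** (`isCyclic_of_stabilizer_eq_top`, `dihedral_of_index_two`): an
  index-`2` cyclic stabiliser `⟨c⟩` and any `s ∉ ⟨c⟩` satisfy `s² = (sc)² = 1` (an element
  moving `p` whose square fixes `p` is an involution, by the two-fixed-point axiom), whence
  `H ≅ D_{ord c}` (`DihedralRecognition`, from `ProjectiveTypeSolvable`).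
* **`A_4`, `S_4`** (`a4_of_signature`, `s4_of_signature`): a Sylow `3`-subgroup is a pole
  stabiliser, hence not normal (a normal stabiliser has index `≤ 2`), so there are `4` of
  them and the conjugation action `H → S_4` is faithful (kernel analysis inside `N(P)`);
  `|H| = 12 = 4!/2` resp. `24 = 4!`.
* **`A_5`** (`a5_of_signature`): a Sylow `2`-subgroup `P` (order `4`) is the centraliser of
  each of its non-identity elements, so `|N(P)| ∣ 24` (`ConjIndex`), `|N(P)| ∈ {4, 12}`;
  `|N(P)| = 4` would produce `45` non-identity `2`-elements each pinned down by one of `≤ 30`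
  poles, so there are `5` Sylow `2`-subgroups; the kernel of `H → S_5` has order dividing
  `12`, contains no involution (`15` conjugates) and no element of order `3` (centraliser of
  order `≤ 10`), so is trivial; `|H| = 60 = 5!/2`.

## Mathlib search

Mathlib (this pin) has Burnside's lemma (`MulAction.sum_card_fixedBy_eq_card_orbits_mul_card_group`),
the class formula (`MulAction.card_eq_sum_card_group_div_card_stabilizer`), Sylow theory
(`Sylow.card_eq_multiplicity`, `card_sylow_modEq_one`, `Sylow.card_dvd_index`,
`Sylow.card_eq_index_normalizer`), `Equiv.Perm.eq_alternatingGroup_of_index_eq_two`,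
`IsPGroup.isMulCommutative_of_card_eq_prime_sq`, `DihedralGroup`, `alternatingGroup`; it has
**no** classification of finite rotation groups / finite subgroups of `PGL_2`, `SO(3)`
(grep `icosahedral`, `octahedral`, `rotation group`, `Klein`: nothing relevant).  Nothing here
duplicates a Mathlib declaration.

## References

* F. Klein, *Vorlesungen über das Ikosaeder und die Auflösung der Gleichungen vom fünften
  Grade*, Teubner (1884), Abschnitt I, Kap. I §§1–2 (the pole-counting classification).
* J. R. Getz, H. Hahn, *An Introduction to Automorphic Representations*, GTM 300 (2024),
  §13.4, Thm. 13.4.4 (statement only). [GetzHahn2024]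
-/

open MulAction Subgroup

namespace Literature.NumberTheory.GaloisRepresentations.KleinAction

variable {H : Type*} [Group H] {X : Type*} [MulAction H X]

/-! ### The two axioms and poles -/

/-- **Axiom (two fixed points)**: every non-identity element of `H` has exactly two fixed
points on `X` (a hypothesis on an action, not a named fact). [folklore] -/
def HasTwoFixedPoints (H X : Type*) [Group H] [MulAction H X] : Prop :=
  ∀ h : H, h ≠ 1 → ∃ p q : X, p ≠ q ∧ fixedBy X h = {p, q}

variable (H) in
/-- A **pole** is a point of `X` fixed by some non-identity element of `H`. [folklore] -/
def IsPole (p : X) : Prop :=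
  ∃ h : H, h ≠ 1 ∧ h • p = p

/-- Poles are permuted by `H`. [folklore] -/
theorem IsPole.smul {p : X} (hp : IsPole H p) (g : H) : IsPole H (g • p) := by
  obtain ⟨h, h1, hh⟩ := hp
  refine ⟨g * h * g⁻¹, fun h' => h1 ?_, ?_⟩
  · rwa [mul_inv_eq_one, mul_eq_left] at h'
  · rw [mul_smul, mul_smul, inv_smul_smul, hh]

/-- A point is a pole iff its stabiliser is non-trivial. [folklore] -/
theorem isPole_iff_stabilizer_ne_bot {p : X} : IsPole H p ↔ stabilizer H p ≠ ⊥ := by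
  rw [Ne, Subgroup.eq_bot_iff_forall]
  simp only [mem_stabilizer_iff, not_forall, exists_prop]
  exact ⟨fun ⟨h, h1, hh⟩ => ⟨h, hh, h1⟩, fun ⟨h, hh, h1⟩ => ⟨h, h1, hh⟩⟩

/-- The stabiliser of a pole has more than one element. [folklore] -/
theorem IsPole.one_lt_card [Finite H] {p : X} (hp : IsPole H p) :
    1 < Nat.card (stabilizer H p) :=
  (stabilizer H p).one_lt_card_iff_ne_bot.mpr (isPole_iff_stabilizer_ne_bot.mp hp)

/-- A point whose stabiliser has more than one element is a pole. [folklore] -/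
theorem isPole_of_one_lt_card [Finite H] {p : X} (hp : 1 < Nat.card (stabilizer H p)) :
    IsPole H p :=
  isPole_iff_stabilizer_ne_bot.mpr ((stabilizer H p).one_lt_card_iff_ne_bot.mp hp)

variable (H X) in
/-- The set of poles, an `H`-stable subset of `X`. [folklore] -/
def poles : SubMulAction H X where
  carrier := {p | IsPole H p}
  smul_mem' g _ hp := IsPole.smul hp g

/-- Membership in `poles` (definitional unfolding). [folklore] -/
theorem mem_poles {p : X} : p ∈ poles H X ↔ IsPole H p := Iff.rfl

/-- Fixed points of a non-identity element are poles. [folklore] -/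
theorem isPole_of_mem_fixedBy {h : H} (h1 : h ≠ 1) {p : X} (hp : p ∈ fixedBy X h) : IsPole H p :=
  ⟨h, h1, hp⟩

/-- Under the axiom, fixed-point sets of non-identity elements are finite. [folklore] -/
theorem finite_fixedBy (h2 : HasTwoFixedPoints H X) {h : H} (h1 : h ≠ 1) :
    (fixedBy X h).Finite := by
  obtain ⟨p, q, -, hpq⟩ := h2 h h1
  rw [hpq]
  exact (Set.finite_singleton q).insert p

/-- Under the axiom, a non-identity element has `2` fixed points. [folklore] -/
theorem ncard_fixedBy (h2 : HasTwoFixedPoints H X) {h : H} (h1 : h ≠ 1) :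
    (fixedBy X h).ncard = 2 := by
  obtain ⟨p, q, hne, hpq⟩ := h2 h h1
  rw [hpq, Set.ncard_pair hne]

/-- For a finite group the set of poles is finite. [folklore] -/
theorem poles_finite [Finite H] (h2 : HasTwoFixedPoints H X) : (poles H X : Set X).Finite := by
  have hsub : (poles H X : Set X) ⊆ ⋃ h ∈ {h : H | h ≠ 1}, fixedBy X h := by
    rintro p ⟨h, h1, hp⟩
    exact Set.mem_biUnion h1 hp
  exact ((Set.toFinite _).biUnion fun h h1 => finite_fixedBy h2 h1).subset hsub

/-- For a finite group the type of poles is finite. [folklore] -/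
theorem finite_poles [Finite H] (h2 : HasTwoFixedPoints H X) : Finite (poles H X) :=
  (poles_finite h2).to_subtype

/-- For `h ≠ 1`, the fixed points of `h` among the poles are its fixed points in `X`.
[folklore] -/
def fixedByPolesEquiv {h : H} (h1 : h ≠ 1) : fixedBy (poles H X) h ≃ fixedBy X h where
  toFun x := ⟨(x.1 : X), by
    have hx := x.2
    rw [mem_fixedBy] at hx ⊢
    rw [← SubMulAction.val_smul, hx]⟩
  invFun p := ⟨⟨p.1, isPole_of_mem_fixedBy h1 p.2⟩, by
    have hp := p.2
    rw [mem_fixedBy] at hp ⊢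
    exact Subtype.ext (by rw [SubMulAction.val_smul]; exact hp)⟩
  left_inv _ := rfl
  right_inv _ := rfl

/-- For `h ≠ 1` there are `2` poles fixed by `h`. [folklore] -/
theorem card_fixedBy_poles (h2 : HasTwoFixedPoints H X) {h : H} (h1 : h ≠ 1) :
    Nat.card (fixedBy (poles H X) h) = 2 := by
  rw [Nat.card_congr (fixedByPolesEquiv h1), Nat.card_coe_set_eq, ncard_fixedBy h2 h1]

/-- **Burnside count**: `|poles| + 2 (|H| - 1) = r |H|`, `r` the number of orbits of poles.
[folklore] -/
theorem burnside [Finite H] (h2 : HasTwoFixedPoints H X) :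
    Nat.card (poles H X) + 2 * (Nat.card H - 1) =
      Nat.card (Quotient (orbitRel H (poles H X))) * Nat.card H := by
  classical
  haveI : Finite (poles H X) := finite_poles h2
  letI := Fintype.ofFinite H
  letI := Fintype.ofFinite (poles H X)
  letI : ∀ g : H, Fintype (fixedBy (poles H X) g) := fun g => Fintype.ofFinite _
  letI : Fintype (Quotient (orbitRel H (poles H X))) := Fintype.ofFinite _
  have hB := sum_card_fixedBy_eq_card_orbits_mul_card_group H (poles H X)
  rw [← Finset.add_sum_erase _ _ (Finset.mem_univ (1 : H))] at hB
  have h1 : Fintype.card (fixedBy (poles H X) (1 : H)) = Fintype.card (poles H X) := by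
    rw [← Nat.card_eq_fintype_card, ← Nat.card_eq_fintype_card, fixedBy_one_eq_univ,
      Nat.card_congr (Equiv.Set.univ _)]
  have hrest : ∑ g ∈ Finset.univ.erase (1 : H), Fintype.card (fixedBy (poles H X) g) =
      2 * (Nat.card H - 1) := by
    rw [Finset.sum_congr rfl (g := fun _ => 2), Finset.sum_const, smul_eq_mul,
      Finset.card_erase_of_mem (Finset.mem_univ _), Finset.card_univ, mul_comm,
      Nat.card_eq_fintype_card]
    intro g hg
    rw [← Nat.card_eq_fintype_card]
    exact card_fixedBy_poles h2 (Finset.ne_of_mem_erase hg)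
  rw [h1, hrest] at hB
  simpa only [Nat.card_eq_fintype_card] using hB

/-- Points in the same orbit have stabilisers of the same order. [folklore] -/
theorem card_stabilizer_eq_of_mem_orbit {p q : X} (h : q ∈ orbit H p) :
    Nat.card (stabilizer H q) = Nat.card (stabilizer H p) := by
  obtain ⟨g, rfl⟩ := h
  exact (Nat.card_congr (stabilizerEquivStabilizer (rfl : g • p = g • p)).toEquiv).symm

/-- A pole and the chosen representative of its orbit have stabilisers of the same order.
[folklore] -/
theorem card_stabilizer_eq_out (x : poles H X) :
    Nat.card (stabilizer H (x : X)) =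
      Nat.card (stabilizer H
        (((Quotient.mk (orbitRel H (poles H X)) x).out : poles H X) : X)) := by
  have hx : (orbitRel H (poles H X)) ((Quotient.mk (orbitRel H (poles H X)) x).out) x :=
    Quotient.mk_out x
  rw [orbitRel_apply] at hx
  obtain ⟨g, hg⟩ := hx
  change g • x = _ at hg
  have hg' : g • (x : X) = (((Quotient.mk (orbitRel H (poles H X)) x).out : poles H X) : X) := by
    rw [← SubMulAction.val_smul, hg]
  exact (Nat.card_congr (stabilizerEquivStabilizer hg'.symm).toEquiv)

/-! ### Arithmetic of `N/a + N/b + N/c = N + 2` -/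

/-- The possible outcomes of the diophantine analysis: one of `a, b, c` is `N/2`, or
`(N; a, b, c)` is `(12; 2,3,3)`, `(24; 2,3,4)`, `(60; 2,3,5)` up to order (recorded
symmetrically, as membership constraints). [folklore] -/
def Concl (N a b c : ℕ) : Prop :=
  (2 * a = N ∨ 2 * b = N ∨ 2 * c = N) ∨
    (N = 12 ∧ (a = 2 ∨ a = 3) ∧ (b = 2 ∨ b = 3) ∧ (c = 2 ∨ c = 3)) ∨
    (N = 24 ∧ (a = 2 ∨ a = 3 ∨ a = 4) ∧ (b = 2 ∨ b = 3 ∨ b = 4) ∧ (c = 2 ∨ c = 3 ∨ c = 4)) ∨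
    (N = 60 ∧ (a = 2 ∨ a = 3 ∨ a = 5) ∧ (b = 2 ∨ b = 3 ∨ b = 5) ∧ (c = 2 ∨ c = 3 ∨ c = 5))

/-- `Concl` is symmetric in its first two arguments. [folklore] -/
theorem Concl.swap₁₂ {N a b c : ℕ} (h : Concl N a b c) : Concl N b a c := by
  rcases h with (h | h | h) | ⟨hN, h1, h2, h3⟩ | ⟨hN, h1, h2, h3⟩ | ⟨hN, h1, h2, h3⟩
  · exact Or.inl (Or.inr (Or.inl h))
  · exact Or.inl (Or.inl h)
  · exact Or.inl (Or.inr (Or.inr h))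
  · exact Or.inr (Or.inl ⟨hN, h2, h1, h3⟩)
  · exact Or.inr (Or.inr (Or.inl ⟨hN, h2, h1, h3⟩))
  · exact Or.inr (Or.inr (Or.inr ⟨hN, h2, h1, h3⟩))

/-- `Concl` is symmetric in its last two arguments. [folklore] -/
theorem Concl.swap₂₃ {N a b c : ℕ} (h : Concl N a b c) : Concl N a c b := by
  rcases h with (h | h | h) | ⟨hN, h1, h2, h3⟩ | ⟨hN, h1, h2, h3⟩ | ⟨hN, h1, h2, h3⟩
  · exact Or.inl (Or.inl h)
  · exact Or.inl (Or.inr (Or.inr h))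
  · exact Or.inl (Or.inr (Or.inl h))
  · exact Or.inr (Or.inl ⟨hN, h1, h3, h2⟩)
  · exact Or.inr (Or.inr (Or.inl ⟨hN, h1, h3, h2⟩))
  · exact Or.inr (Or.inr (Or.inr ⟨hN, h1, h3, h2⟩))

/-- The diophantine analysis of `N/2 + N/b + N/c = N + 2`, case `b ≤ 3`. [folklore] -/
theorem arith_core_le {N b c y z : ℕ} (h2N : 2 ∣ N) (hc : 2 ≤ c)
    (hy : N = b * y) (hz : N = c * z) (hsum : N / 2 + y + z = N + 2) (hb2 : 2 ≤ b)
    (hb3 : b ≤ 3) : Concl N 2 b c := by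
  obtain ⟨x, hx⟩ := h2N
  interval_cases b
  · have hz2 : z = 2 := by omega
    subst hz2
    exact Or.inl (Or.inr (Or.inr (by omega)))
  · obtain ⟨m, hm⟩ : ∃ m, N = 6 * m := ⟨N / 6, by omega⟩
    subst hm
    have hz2 : z = m + 2 := by omega
    subst hz2
    have hc6 : c < 6 := by
      by_contra h
      push Not at h
      have : 6 * (m + 2) ≤ c * (m + 2) := Nat.mul_le_mul_right _ h
      omega
    interval_cases c
    · exact Or.inl (Or.inr (Or.inl (by omega)))
    · exact Or.inr (Or.inl ⟨by omega, Or.inl rfl, Or.inr rfl, Or.inr rfl⟩)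
    · exact Or.inr (Or.inr (Or.inl
        ⟨by omega, Or.inl rfl, Or.inr (Or.inl rfl), Or.inr (Or.inr rfl)⟩))
    · exact Or.inr (Or.inr (Or.inr
        ⟨by omega, Or.inl rfl, Or.inr (Or.inl rfl), Or.inr (Or.inr rfl)⟩))

/-- The diophantine analysis of `N/2 + N/b + N/c = N + 2`. [folklore] -/
theorem arith_core {N b c : ℕ} (h2N : 2 ∣ N) (hb : 2 ≤ b) (hc : 2 ≤ c)
    (hbN : b ∣ N) (hcN : c ∣ N) (hsum : N / 2 + N / b + N / c = N + 2) : Concl N 2 b c := by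
  obtain ⟨y, hy⟩ := hbN
  obtain ⟨z, hz⟩ := hcN
  have hyv : N / b = y := by rw [hy, Nat.mul_div_cancel_left _ (by omega)]
  have hzv : N / c = z := by rw [hz, Nat.mul_div_cancel_left _ (by omega)]
  rw [hyv, hzv] at hsum
  have hbc : b ≤ 3 ∨ c ≤ 3 := by
    by_contra h
    push Not at h
    have h1 : 4 * y ≤ b * y := Nat.mul_le_mul_right _ (by omega)
    have h1' : 4 * z ≤ c * z := Nat.mul_le_mul_right _ (by omega)
    omega
  rcases hbc with h | h
  · exact arith_core_le h2N hc hy hz hsum hb h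
  · exact (arith_core_le h2N hb hz hy (by omega) hc h).swap₂₃

/-- The diophantine analysis of `N/a + N/b + N/c = N + 2` with `a, b, c ≥ 2` dividing `N`:
either one of them is `N/2`, or `(N; a, b, c)` is `(12; 2,3,3)`, `(24; 2,3,4)`, `(60; 2,3,5)` up
to order. [folklore] -/
theorem arith_three {N a b c : ℕ} (ha : 2 ≤ a) (hb : 2 ≤ b) (hc : 2 ≤ c)
    (haN : a ∣ N) (hbN : b ∣ N) (hcN : c ∣ N) (hsum : N / a + N / b + N / c = N + 2) :
    Concl N a b c := by
  have h2 : a = 2 ∨ b = 2 ∨ c = 2 := by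
    by_contra h
    push Not at h
    obtain ⟨x, hx⟩ := haN
    obtain ⟨y, hy⟩ := hbN
    obtain ⟨z, hz⟩ := hcN
    have hxv : N / a = x := by rw [hx, Nat.mul_div_cancel_left _ (by omega)]
    have hyv : N / b = y := by rw [hy, Nat.mul_div_cancel_left _ (by omega)]
    have hzv : N / c = z := by rw [hz, Nat.mul_div_cancel_left _ (by omega)]
    rw [hxv, hyv, hzv] at hsum
    have h1 : 3 * x ≤ a * x := Nat.mul_le_mul_right _ (by omega)
    have h1' : 3 * y ≤ b * y := Nat.mul_le_mul_right _ (by omega)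
    have h1'' : 3 * z ≤ c * z := Nat.mul_le_mul_right _ (by omega)
    omega
  rcases h2 with h | h | h
  · subst h
    exact arith_core haN hb hc hbN hcN hsum
  · subst h
    exact (arith_core hbN ha hc haN hcN (by omega)).swap₁₂
  · subst h
    exact (arith_core hcN ha hb haN hbN (by omega)).swap₁₂.swap₂₃

/-- In the signature `(60; 2, 3, 5)` only one of the three stabiliser orders is `2`.
[folklore] -/
theorem two_unique {a b c : ℕ} (ha : a = 2 ∨ a = 3 ∨ a = 5) (hb : b = 2 ∨ b = 3 ∨ b = 5)
    (hc : c = 2 ∨ c = 3 ∨ c = 5) (hs : 60 / a + 60 / b + 60 / c = 60 + 2) :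
    (a = 2 → b ≠ 2) ∧ (a = 2 → c ≠ 2) ∧ (b = 2 → c ≠ 2) := by
  refine ⟨?_, ?_, ?_⟩
  · rintro rfl rfl
    rcases hc with h | h | h <;> subst h <;> omega
  · rintro rfl rfl
    rcases hb with h | h | h <;> subst h <;> omega
  · rintro rfl rfl
    rcases ha with h | h | h <;> subst h <;> omega

/-- A subgroup of half the order has index `2`. [folklore] -/
theorem index_eq_two_of_card [Finite H] {K : Subgroup H} (h : 2 * Nat.card K = Nat.card H) :
    K.index = 2 :=
  Nat.eq_of_mul_eq_mul_right (Nat.card_pos (α := K)) (K.index_mul_card.trans h.symm)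

/-! ### The signature -/

/-- **The signature of a finite group with the two-fixed-point property.**  Burnside's count
over the poles and the class formula leave six possibilities: `H` trivial; a point fixed by all
of `H`; a point whose stabiliser has index `2`; or `|H| = 12, 24, 60` with all pole stabilisers
of order in `{2,3}`, `{2,3,4}`, `{2,3,5}` respectively (and, for `60`, all poles with stabiliser
of order `2` in a single orbit). [folklore] -/
theorem signature [Finite H] (h2 : HasTwoFixedPoints H X) :
    Nat.card H = 1 ∨
    (∃ p : X, stabilizer H p = ⊤) ∨
    (∃ p : X, (stabilizer H p).index = 2) ∨
    (Nat.card H = 12 ∧ ∀ q : X, IsPole H q →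
      Nat.card (stabilizer H q) = 2 ∨ Nat.card (stabilizer H q) = 3) ∨
    (Nat.card H = 24 ∧ ∀ q : X, IsPole H q →
      Nat.card (stabilizer H q) = 2 ∨ Nat.card (stabilizer H q) = 3 ∨
        Nat.card (stabilizer H q) = 4) ∨
    (Nat.card H = 60 ∧ (∀ q : X, IsPole H q →
      Nat.card (stabilizer H q) = 2 ∨ Nat.card (stabilizer H q) = 3 ∨
        Nat.card (stabilizer H q) = 5) ∧
      ∃ p₀ : X, ∀ q : X, Nat.card (stabilizer H q) = 2 → q ∈ orbit H p₀) := by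
  classical
  haveI : Finite (poles H X) := finite_poles h2
  have hN0 : 0 < Nat.card H := Nat.card_pos
  obtain ⟨r, ⟨e⟩⟩ := Finite.exists_equiv_fin (Quotient (orbitRel H (poles H X)))
  -- the stabiliser orders of the orbit representatives
  set n : Fin r → ℕ := fun i =>
    Nat.card (stabilizer H (((e.symm i).out : poles H X) : X)) with hn
  have hr : Nat.card (Quotient (orbitRel H (poles H X))) = r := by
    rw [Nat.card_congr e, Nat.card_eq_fintype_card, Fintype.card_fin]
  -- class formula
  have hclass : Nat.card (poles H X) = ∑ i : Fin r, Nat.card H / n i := by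
    letI := Fintype.ofFinite H
    letI := Fintype.ofFinite (poles H X)
    letI : Fintype (Quotient (orbitRel H (poles H X))) := Fintype.ofEquiv _ e.symm
    letI : ∀ b : poles H X, Fintype (stabilizer H b) := fun b => Fintype.ofFinite _
    have hcf := MulAction.card_eq_sum_card_group_div_card_stabilizer H (poles H X)
    simp only [← Nat.card_eq_fintype_card, SubMulAction.stabilizer_of_subMul] at hcf
    rw [hcf]
    exact Fintype.sum_equiv e _ _ (fun ω => by simp only [hn, Equiv.symm_apply_apply])
  have hB := burnside h2
  rw [hr, hclass] at hB
  have hn_dvd : ∀ i, n i ∣ Nat.card H := fun i => (stabilizer H _).card_subgroup_dvd_card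
  have hn_two : ∀ i, 2 ≤ n i := fun i => IsPole.one_lt_card ((e.symm i).out).2
  have hterm_le : ∀ i, Nat.card H / n i ≤ Nat.card H / 2 := fun i =>
    Nat.div_le_div_left (hn_two i) (by norm_num)
  have hterm_ge : ∀ i, 1 ≤ Nat.card H / n i := fun i =>
    Nat.div_pos (Nat.le_of_dvd hN0 (hn_dvd i)) (by have := hn_two i; omega)
  have hsum_le : ∑ i : Fin r, Nat.card H / n i ≤ r * (Nat.card H / 2) := by
    have := Finset.sum_le_card_nsmul (Finset.univ : Finset (Fin r))
      (fun i => Nat.card H / n i) (Nat.card H / 2) (fun i _ => hterm_le i)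
    simpa using this
  have hsum_ge : r ≤ ∑ i : Fin r, Nat.card H / n i := by
    have := Finset.card_nsmul_le_sum (Finset.univ : Finset (Fin r))
      (fun i => Nat.card H / n i) 1 (fun i _ => hterm_ge i)
    simpa using this
  set S := ∑ i : Fin r, Nat.card H / n i with hS
  have hr3 : r ≤ 3 := by
    by_contra hr4
    push Not at hr4
    have h1 : r * (Nat.card H / 2) + r * (Nat.card H - Nat.card H / 2) = r * Nat.card H := by
      rw [← Nat.mul_add]
      congr 1
      omega
    have h3 : 4 * (Nat.card H - Nat.card H / 2) ≤ r * (Nat.card H - Nat.card H / 2) :=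
      Nat.mul_le_mul_right _ hr4
    omega
  obtain rfl | rfl | rfl | rfl : r = 0 ∨ r = 1 ∨ r = 2 ∨ r = 3 := by omega
  · -- no orbit of poles: `H` is trivial
    left
    have hS0 : S = 0 := by rw [hS]; simp
    omega
  · -- one orbit: impossible
    exfalso
    omega
  · -- two orbits: both are fixed points of the whole group
    right; left
    have hS2 : S = 2 := by omega
    rw [hS, Fin.sum_univ_two] at hS2
    have h0 : Nat.card H / n 0 = 1 := by
      have := hterm_ge 0
      have := hterm_ge 1
      omega
    have hn0 : n 0 = Nat.card H := by
      have := Nat.div_mul_cancel (hn_dvd 0)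
      rwa [h0, one_mul] at this
    exact ⟨_, Subgroup.eq_top_of_card_eq _ hn0⟩
  · -- three orbits
    have hS3 : S = Nat.card H + 2 := by omega
    rw [hS, Fin.sum_univ_three] at hS3
    have key := arith_three (hn_two 0) (hn_two 1) (hn_two 2) (hn_dvd 0) (hn_dvd 1) (hn_dvd 2)
      hS3
    -- every pole's stabiliser order is one of `n 0, n 1, n 2`
    have hpole : ∀ q : X, IsPole H q → ∃ i : Fin 3, Nat.card (stabilizer H q) = n i := by
      intro q hq
      refine ⟨e (Quotient.mk _ ⟨q, hq⟩), ?_⟩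
      simp only [hn, Equiv.symm_apply_apply]
      exact card_stabilizer_eq_out ⟨q, hq⟩
    have hvals : ∀ (P : ℕ → Prop), P (n 0) → P (n 1) → P (n 2) → ∀ q : X, IsPole H q →
        P (Nat.card (stabilizer H q)) := by
      intro P h0 h1 h2' q hq
      obtain ⟨i, hi⟩ := hpole q hq
      rw [hi]
      fin_cases i
      · exact h0
      · exact h1
      · exact h2'
    rcases key with (h | h | h) | ⟨h12, ha, hb, hc⟩ | ⟨h24, ha, hb, hc⟩ | ⟨h60, ha, hb, hc⟩
    · exact Or.inr (Or.inr (Or.inl ⟨_, index_eq_two_of_card h⟩))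
    · exact Or.inr (Or.inr (Or.inl ⟨_, index_eq_two_of_card h⟩))
    · exact Or.inr (Or.inr (Or.inl ⟨_, index_eq_two_of_card h⟩))
    · exact Or.inr (Or.inr (Or.inr (Or.inl ⟨h12,
        hvals (fun m => m = 2 ∨ m = 3) ha hb hc⟩)))
    · exact Or.inr (Or.inr (Or.inr (Or.inr (Or.inl ⟨h24,
        hvals (fun m => m = 2 ∨ m = 3 ∨ m = 4) ha hb hc⟩))))
    · refine Or.inr (Or.inr (Or.inr (Or.inr (Or.inr ⟨h60,
        hvals (fun m => m = 2 ∨ m = 3 ∨ m = 5) ha hb hc, ?_⟩))))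
      -- an orbit with stabilisers of order `2` exists ...
      have hex : ∃ i : Fin 3, n i = 2 := by
        by_contra hne
        push Not at hne
        have hle : ∀ i : Fin 3, (n i = 2 ∨ n i = 3 ∨ n i = 5) → Nat.card H / n i ≤ 20 := by
          intro i hi
          have h3 : 3 ≤ n i := by
            rcases hi with h | h | h
            · exact absurd h (hne i)
            · omega
            · omega
          calc Nat.card H / n i ≤ Nat.card H / 3 := Nat.div_le_div_left h3 (by norm_num)
            _ = 20 := by rw [h60]
        have := hle 0 ha
        have := hle 1 hb
        have := hle 2 hc
        omega
      obtain ⟨i₀, hi₀⟩ := hex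
      -- ... and is unique
      have hu := two_unique ha hb hc (by rwa [h60] at hS3)
      refine ⟨(((e.symm i₀).out : poles H X) : X), fun q hq2 => ?_⟩
      have hq : IsPole H q := isPole_of_one_lt_card (by rw [hq2]; norm_num)
      set j := e (Quotient.mk _ ⟨q, hq⟩) with hj
      have hnj : n j = 2 := by
        simp only [hn, hj, Equiv.symm_apply_apply]
        rw [← card_stabilizer_eq_out ⟨q, hq⟩]
        exact hq2
      have hji : j = i₀ := by
        obtain ⟨u1, u2, u3⟩ := hu
        clear_value j
        fin_cases j <;> fin_cases i₀
        · rfl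
        · exact absurd hi₀ (u1 hnj)
        · exact absurd hi₀ (u2 hnj)
        · exact absurd hnj (u1 hi₀)
        · rfl
        · exact absurd hi₀ (u3 hnj)
        · exact absurd hnj (u2 hi₀)
        · exact absurd hnj (u3 hi₀)
        · rfl
      have he : e.symm i₀ = Quotient.mk _ ⟨q, hq⟩ := by
        rw [← hji, hj, Equiv.symm_apply_apply]
      have hx : (orbitRel H (poles H X)) ((e.symm i₀).out) ⟨q, hq⟩ := by
        rw [he]
        exact Quotient.mk_out _
      have hx' := (orbitRel H (poles H X)).symm' hx
      rw [orbitRel_apply] at hx'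
      obtain ⟨g, hg⟩ := hx'
      change g • (e.symm i₀).out = _ at hg
      have hgX : g • (((e.symm i₀).out : poles H X) : X) = q := by
        rw [← SubMulAction.val_smul, hg]
      rw [← hgX]
      exact mem_orbit _ _

/-! ### Consequences of the axioms used in the identifications -/

/-- A point fixed by the whole group: `H` is its own (cyclic) stabiliser. [folklore] -/
theorem isCyclic_of_stabilizer_eq_top (hcyc : ∀ p : X, IsCyclic (stabilizer H p)) {p : X}
    (h : stabilizer H p = ⊤) : IsCyclic H := by
  haveI := hcyc p
  exact isCyclic_of_surjective ((MulEquiv.subgroupCongr h).trans Subgroup.topEquiv)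
    ((MulEquiv.subgroupCongr h).trans Subgroup.topEquiv).surjective

/-- If `x` moves `p` but `x²` fixes `p`, then `x² = 1`: otherwise `x²` would fix the four
distinct points `p`, `x • p` and the two fixed points of `x`. [folklore] -/
theorem mul_self_eq_one_of_smul_ne (h2 : HasTwoFixedPoints H X) {p : X} {x : H}
    (hx : x • p ≠ p) (hx2 : (x * x) • p = p) : x * x = 1 := by
  by_contra hxx
  have hx1 : x ≠ 1 := by
    rintro rfl
    exact hx (one_smul _ _)
  obtain ⟨u, v, -, hFxx⟩ := h2 (x * x) hxx
  obtain ⟨u', v', -, hFx⟩ := h2 x hx1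
  have hu'x : x • u' = u' := by
    have h : u' ∈ fixedBy X x := by
      rw [hFx]
      exact Set.mem_insert _ _
    exact h
  have hp : p ∈ fixedBy X (x * x) := hx2
  have hxp : x • p ∈ fixedBy X (x * x) := by
    show (x * x) • x • p = x • p
    rw [← mul_smul, show x * x * x = x * (x * x) from mul_assoc x x x, mul_smul, hx2]
  have hu' : u' ∈ fixedBy X (x * x) := by
    show (x * x) • u' = u'
    rw [mul_smul, hu'x, hu'x]
  rw [hFxx] at hp hxp hu'
  simp only [Set.mem_insert_iff, Set.mem_singleton_iff] at hp hxp hu'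
  have key : u' = p ∨ u' = x • p := by
    rcases hp with hp | hp <;> rcases hxp with hxp | hxp
    · exact absurd (hxp.trans hp.symm) hx
    · rcases hu' with h | h
      · exact Or.inl (h.trans hp.symm)
      · exact Or.inr (h.trans hxp.symm)
    · rcases hu' with h | h
      · exact Or.inr (h.trans hxp.symm)
      · exact Or.inl (h.trans hp.symm)
    · exact absurd (hxp.trans hp.symm) hx
  rcases key with rfl | rfl
  · exact hx hu'x
  · apply hx
    rw [← mul_smul, hx2] at hu'x
    exact hu'x.symm

/-- If a non-identity `a` fixes every point of the orbit of `q`, the stabiliser of `q` has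
index at most `2`. [folklore] -/
theorem index_stabilizer_le_two (h2 : HasTwoFixedPoints H X) {a : H} (ha : a ≠ 1) {q : X}
    (h : ∀ g : H, a • g • q = g • q) : (stabilizer H q).index ≤ 2 := by
  rw [index_stabilizer, ← ncard_fixedBy h2 ha]
  apply Set.ncard_le_ncard _ (finite_fixedBy h2 ha)
  rintro _ ⟨g, rfl⟩
  exact h g

/-- If `a ≠ 1` fixes `q` and the stabiliser of `q` is normal, that stabiliser has index at
most `2`. [folklore] -/
theorem index_le_two_of_normal_stabilizer (h2 : HasTwoFixedPoints H X) {q : X} {a : H}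
    (ha1 : a ≠ 1) (haq : a • q = q) (hn : (stabilizer H q).Normal) :
    (stabilizer H q).index ≤ 2 := by
  refine index_stabilizer_le_two h2 ha1 fun g => ?_
  have : g⁻¹ * a * g⁻¹⁻¹ ∈ stabilizer H q := hn.conj_mem a (mem_stabilizer_iff.mpr haq) g⁻¹
  rw [inv_inv, mem_stabilizer_iff, mul_smul, mul_smul, inv_smul_eq_iff] at this
  exact this

/-- The centraliser of a non-identity element `z` is at most twice as large as the stabiliser
of a fixed point of `z` (it permutes the two fixed points of `z`). [folklore] -/
theorem card_centralizer_le [Finite H] (h2 : HasTwoFixedPoints H X) {z : H} (hz : z ≠ 1)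
    {q : X} (hq : z • q = q) :
    Nat.card (centralizer ({z} : Set H)) ≤ 2 * Nat.card (stabilizer H q) := by
  set C := centralizer ({z} : Set H)
  have horb : orbit C q ⊆ fixedBy X z := by
    rintro _ ⟨c, rfl⟩
    show z • ((c : H) • q) = (c : H) • q
    have hc : z * (c : H) = c * z := mem_centralizer_iff.mp c.2 z (Set.mem_singleton z)
    rw [← mul_smul, hc, mul_smul, hq]
  have hidx : (stabilizer C q).index ≤ 2 := by
    rw [index_stabilizer, ← ncard_fixedBy h2 hz]
    exact Set.ncard_le_ncard horb (finite_fixedBy h2 hz)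
  have hst : Nat.card (stabilizer C q) ≤ Nat.card (stabilizer H q) := by
    refine Nat.card_le_card_of_injective
      (fun x => (⟨(x.1 : H), mem_stabilizer_iff.mpr (mem_stabilizer_iff.mp x.2)⟩ :
        stabilizer H q)) ?_
    intro x y hxy
    simp only [Subtype.mk.injEq] at hxy
    exact Subtype.ext (Subtype.ext hxy)
  calc Nat.card C = (stabilizer C q).index * Nat.card (stabilizer C q) :=
      (stabilizer C q).index_mul_card.symm
    _ ≤ 2 * Nat.card (stabilizer H q) := Nat.mul_le_mul hidx hst

/-- In a subgroup of order `2`, two non-identity elements coincide. [folklore] -/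
theorem eq_of_card_eq_two {K : Subgroup H} (hK : Nat.card K = 2) {x y : H} (hx : x ∈ K)
    (hy : y ∈ K) (hx1 : x ≠ 1) (hy1 : y ≠ 1) : x = y := by
  obtain ⟨w, -, hw⟩ := (Nat.card_eq_two_iff' (1 : K)).mp hK
  have h1 := hw ⟨x, hx⟩ (fun h => hx1 (congrArg Subtype.val h))
  have h1' := hw ⟨y, hy⟩ (fun h => hy1 (congrArg Subtype.val h))
  exact congrArg Subtype.val (h1.trans h1'.symm)

/-- The order of an element fixing `q` divides the order of the stabiliser of `q`.
[folklore] -/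
theorem orderOf_dvd_card_stabilizer {a : H} {q : X} (h : a • q = q) :
    orderOf a ∣ Nat.card (stabilizer H q) := by
  have := orderOf_dvd_natCard (⟨a, mem_stabilizer_iff.mpr h⟩ : stabilizer H q)
  rwa [Subgroup.orderOf_mk] at this

/-- If all conjugates of `z` lie in a set `S`, then `[H : C_H(z)] ≤ |S|`. [folklore] -/
theorem index_centralizer_le [Finite H] {z : H} {S : Set H} (h : ∀ g : H, g * z * g⁻¹ ∈ S) :
    (centralizer ({z} : Set H)).index ≤ S.ncard := by
  have e := (MulAction.orbitEquivQuotientStabilizer (ConjAct H) z).trans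
    (Subgroup.quotientEquivOfEq (ConjAct.stabilizer_eq_centralizer z))
  calc (centralizer ({z} : Set H)).index = Nat.card (orbit (ConjAct H) z) :=
      (Nat.card_congr e).symm
    _ = (orbit (ConjAct H) z).ncard := Nat.card_coe_set_eq _
    _ ≤ S.ncard := by
      apply Set.ncard_le_ncard _ (Set.toFinite S)
      rintro _ ⟨g, rfl⟩
      show g • z ∈ S
      rw [ConjAct.smul_def]
      exact h _

/-- Cauchy's theorem inside a subgroup. [folklore] -/
theorem exists_mem_orderOf_eq [Finite H] {K : Subgroup H} {p : ℕ} [Fact p.Prime]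
    (h : p ∣ Nat.card K) : ∃ z ∈ K, orderOf z = p := by
  obtain ⟨z, hz⟩ := exists_prime_orderOf_dvd_card' (G := K) p h
  exact ⟨z, z.2, by rw [Subgroup.orderOf_coe z]; exact hz⟩

/-- The `ncard` of a subgroup coerced to a set is its `Nat.card`. [folklore] -/
theorem ncard_coe_subgroup (K : Subgroup H) : (K : Set H).ncard = Nat.card K := by
  rw [← Nat.card_coe_set_eq, SetLike.coe_sort_coe]

/-! ### Dihedral case -/

/-- **A stabiliser of index `2` forces `H` dihedral.**  The stabiliser `A = ⟨c⟩` is cyclic of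
index `2`; every `x ∉ A` satisfies `x² = 1` (`mul_self_eq_one_of_smul_ne`), so for `s ∉ A`
both `s² = 1` and `(sc)² = 1`, i.e. `s c s⁻¹ = c⁻¹`, and `H = ⟨c⟩ ∪ s⟨c⟩ ≅ D_{ord c}`
(`DihedralRecognition`). [folklore] -/
theorem dihedral_of_index_two (h2 : HasTwoFixedPoints H X)
    (hcyc : ∀ p : X, IsCyclic (stabilizer H p)) {p : X} (hi : (stabilizer H p).index = 2) :
    ∃ m : ℕ, Nonempty (H ≃* DihedralGroup m) := by
  set A := stabilizer H p with hA
  obtain ⟨c, hc⟩ := A.isCyclic_iff_exists_zpowers_eq_top.mp (hcyc p)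
  have hA' : A ≠ ⊤ := by
    intro h
    rw [h, Subgroup.index_top] at hi
    exact absurd hi (by norm_num)
  obtain ⟨s, hs⟩ : ∃ s, s ∉ A := by
    by_contra h
    push Not at h
    exact hA' (eq_top_iff.mpr fun x _ => h x)
  have key : ∀ x, x ∉ A → x * x = 1 := fun x hx =>
    mul_self_eq_one_of_smul_ne h2 hx (Subgroup.mul_self_mem_of_index_two hi x)
  have hs2 := key s hs
  have hcA : c ∈ A := by
    rw [← hc]
    exact mem_zpowers c
  have hsc : s * c ∉ A := by
    rw [Subgroup.mul_mem_iff_of_index_two hi]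
    exact fun h => hs (h.mpr hcA)
  have hsc2 := key (s * c) hsc
  have hsinv : s⁻¹ = s := by rw [inv_eq_iff_mul_eq_one, hs2]
  have hrel : s * c * s⁻¹ = c⁻¹ := by
    rw [hsinv]
    calc s * c * s = s * c * s * c * c⁻¹ := by group
      _ = c⁻¹ := by rw [show s * c * s * c = s * c * (s * c) from mul_assoc (s * c) s c, hsc2,
          one_mul]
  have hsC : s ∉ zpowers c := by rwa [hc]
  have hcover : ∀ x : H, x ∈ zpowers c ∨ s⁻¹ * x ∈ zpowers c := by
    intro x
    rw [hc]
    by_cases hx : x ∈ A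
    · exact Or.inl hx
    · right
      rw [Subgroup.mul_mem_iff_of_index_two hi, inv_mem_iff]
      exact iff_of_false hs hx
  exact ⟨orderOf c, DihedralRecognition.nonempty_mulEquiv_dihedralGroup hs2 hrel hsC hcover⟩

/-! ### Sylow machinery -/

/-- `(p ^ a * m).factorization p = a` when `p ∤ m`. [folklore] -/
theorem factorization_eq_of_eq {p N a m : ℕ} (hp : p.Prime) (hH : N = p ^ a * m)
    (hm : ¬ p ∣ m) : N.factorization p = a := by
  have hm0 : m ≠ 0 := by
    rintro rfl
    exact hm (dvd_zero p)
  rw [hH, Nat.factorization_mul (pow_ne_zero _ hp.ne_zero) hm0, Finsupp.add_apply,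
    Nat.factorization_pow, Finsupp.smul_apply, smul_eq_mul, hp.factorization_self,
    mul_one, Nat.factorization_eq_zero_of_not_dvd hm, add_zero]

/-- The order of a Sylow `p`-subgroup of a group of order `p ^ a * m`, `p ∤ m`, is `p ^ a`.
[folklore] -/
theorem card_sylow_of_card [Finite H] {p : ℕ} [hp : Fact p.Prime] (P : Sylow p H) (a m : ℕ)
    (hH : Nat.card H = p ^ a * m) (hm : ¬ p ∣ m) : Nat.card (P : Subgroup H) = p ^ a := by
  have := Sylow.card_eq_multiplicity P
  rw [factorization_eq_of_eq hp.out hH hm] at this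
  exact this

/-- An element of the kernel of the conjugation action on Sylow subgroups normalises every
Sylow subgroup. [folklore] -/
theorem mem_normalizer_of_mem_ker {p : ℕ} {k : H}
    (hk : k ∈ (MulAction.toPermHom H (Sylow p H)).ker) (P : Sylow p H) :
    k ∈ normalizer ((P : Subgroup H) : Set H) := by
  have hfix : k • P = P := by
    have := Equiv.congr_fun (MonoidHom.mem_ker.mp hk) P
    simpa using this
  exact Sylow.smul_eq_iff_mem_normalizer.mp hfix

/-- A faithful conjugation action on `m` Sylow subgroups of a group of order `m!` is an
isomorphism onto `S_m`. [folklore] -/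
theorem nonempty_mulEquiv_perm_of_injective [Finite H] {p m : ℕ}
    (hm : Nat.card (Sylow p H) = m)
    (hinj : Function.Injective (MulAction.toPermHom H (Sylow p H)))
    (hc : Nat.card H = m.factorial) : Nonempty (H ≃* Equiv.Perm (Fin m)) := by
  set f : H →* Equiv.Perm (Fin m) :=
    (Equiv.permCongrHom (Finite.equivFinOfCardEq hm)).toMonoidHom.comp
      (MulAction.toPermHom H (Sylow p H))
  have hf : Function.Injective f := fun _ _ hab => hinj ((Equiv.permCongrHom _).injective hab)
  refine ⟨MulEquiv.ofBijective f (hf.bijective_of_nat_card_le ?_)⟩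
  rw [hc, Nat.card_perm, Nat.card_fin]

/-- A faithful conjugation action on `m` Sylow subgroups of a group of order `m!/2` is an
isomorphism onto `A_m`. [folklore] -/
theorem nonempty_mulEquiv_alternating_of_injective [Finite H] {p m : ℕ}
    (hm : Nat.card (Sylow p H) = m)
    (hinj : Function.Injective (MulAction.toPermHom H (Sylow p H)))
    (hc : 2 * Nat.card H = m.factorial) : Nonempty (H ≃* alternatingGroup (Fin m)) := by
  set f : H →* Equiv.Perm (Fin m) :=
    (Equiv.permCongrHom (Finite.equivFinOfCardEq hm)).toMonoidHom.comp
      (MulAction.toPermHom H (Sylow p H))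
  have hf : Function.Injective f := fun _ _ hab => hinj ((Equiv.permCongrHom _).injective hab)
  have hcard : Nat.card f.range = Nat.card H :=
    (Nat.card_congr (MonoidHom.ofInjective hf).toEquiv).symm
  have hidx : f.range.index = 2 := by
    have := f.range.index_mul_card
    rw [hcard, Nat.card_perm, Nat.card_fin, ← hc] at this
    exact Nat.eq_of_mul_eq_mul_right Nat.card_pos this
  exact ⟨(MonoidHom.ofInjective hf).trans
    (MulEquiv.subgroupCongr (Equiv.Perm.eq_alternatingGroup_of_index_eq_two hidx))⟩

/-- A Sylow subgroup of prime order `p` is the stabiliser of a pole, provided every pole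
stabiliser of order divisible by `p` has order exactly `p`. [folklore] -/
theorem sylow_eq_stabilizer [Finite H] (h2 : HasTwoFixedPoints H X) {p : ℕ} [hp : Fact p.Prime]
    (P : Sylow p H) (hP : Nat.card (P : Subgroup H) = p)
    (hallow : ∀ q : X, IsPole H q → p ∣ Nat.card (stabilizer H q) →
      Nat.card (stabilizer H q) = p) :
    ∃ (q : X) (a : H), a ∈ (P : Subgroup H) ∧ a ≠ 1 ∧ a • q = q ∧
      (P : Subgroup H) = stabilizer H q := by
  obtain ⟨a, haP, ha1⟩ : ∃ a ∈ (P : Subgroup H), a ≠ 1 := by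
    rcases (P : Subgroup H).bot_or_exists_ne_one with h | h
    · exfalso
      rw [h, card_bot] at hP
      exact hp.out.one_lt.ne hP
    · exact h
  obtain ⟨q, q', -, hF⟩ := h2 a ha1
  have haq : a • q = q := by
    show q ∈ fixedBy X a
    rw [hF]
    exact Set.mem_insert _ _
  refine ⟨q, a, haP, ha1, haq, ?_⟩
  have hq : IsPole H q := ⟨a, ha1, haq⟩
  have hoa : orderOf a = p := by
    have h1 : orderOf a ∣ p := by
      rw [← hP]
      have := orderOf_dvd_natCard (⟨a, haP⟩ : (P : Subgroup H))
      rwa [Subgroup.orderOf_mk] at this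
    exact ((Nat.dvd_prime hp.out).mp h1).resolve_left (orderOf_eq_one_iff.not.mpr ha1)
  have hcard := hallow q hq (hoa ▸ orderOf_dvd_card_stabilizer haq)
  have hza : Nat.card (zpowers a) = p := by rw [Nat.card_zpowers, hoa]
  have h1 : zpowers a = (P : Subgroup H) :=
    eq_of_le_of_card_ge (zpowers_le.mpr haP) (by rw [hza, hP])
  have h1' : zpowers a = stabilizer H q :=
    eq_of_le_of_card_ge (zpowers_le.mpr (mem_stabilizer_iff.mpr haq)) (by rw [hza, hcard])
  exact h1.symm.trans h1'

/-- A Sylow subgroup of prime order `p` is **not normal** when `|H| > 2p` (under the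
hypotheses of `sylow_eq_stabilizer`): a normal stabiliser has index `≤ 2`. [folklore] -/
theorem not_normal_sylow [Finite H] (h2 : HasTwoFixedPoints H X) {p : ℕ} [Fact p.Prime]
    (P : Sylow p H) (hP : Nat.card (P : Subgroup H) = p)
    (hallow : ∀ q : X, IsPole H q → p ∣ Nat.card (stabilizer H q) →
      Nat.card (stabilizer H q) = p)
    (hbig : 2 * p < Nat.card H) : ¬ (P : Subgroup H).Normal := by
  intro hn
  obtain ⟨q, a, -, ha1, haq, hPq⟩ := sylow_eq_stabilizer h2 P hP hallow
  rw [hPq] at hn hP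
  have hidx := index_le_two_of_normal_stabilizer h2 ha1 haq hn
  have h1 := (stabilizer H q).index_mul_card
  rw [hP] at h1
  have : (stabilizer H q).index * p ≤ 2 * p := Nat.mul_le_mul_right _ hidx
  omega

/-- Two distinct subgroups of the same prime order meet trivially. [folklore] -/
theorem inf_eq_bot_of_prime_card [Finite H] {p : ℕ} (hp : p.Prime) {A B : Subgroup H}
    (hA : Nat.card A = p) (hB : Nat.card B = p) (hne : A ≠ B) : A ⊓ B = ⊥ := by
  have h1 : Nat.card (A ⊓ B : Subgroup H) ∣ p := hA ▸ card_dvd_of_le inf_le_left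
  rcases (Nat.dvd_prime hp).mp h1 with h | h
  · exact (A ⊓ B).eq_bot_of_card_eq h
  · exfalso
    apply hne
    have hAB : A ⊓ B = A := eq_of_le_of_card_ge inf_le_left (by rw [h, hA])
    have hBA : A ⊓ B = B := eq_of_le_of_card_ge inf_le_right (by rw [h, hB])
    exact hAB.symm.trans hBA

/-- **Counting a union of subgroups**: pairwise trivially-intersecting subgroups `Q i ≤ K`
contribute `∑ (|Q i| - 1) ≤ |K| - 1` non-identity elements. [folklore] -/
theorem sum_card_sub_one_le [Finite H] {ι : Type*} [Fintype ι] (Q : ι → Subgroup H)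
    (hdisj : ∀ i j, i ≠ j → Q i ⊓ Q j = ⊥) (K : Subgroup H) (hle : ∀ i, Q i ≤ K) :
    ∑ i, (Nat.card (Q i) - 1) ≤ Nat.card K - 1 := by
  have h1 : Nat.card (Σ i, ConjIndex.Nontriv (Q i)) = ∑ i, (Nat.card (Q i) - 1) := by
    rw [Nat.card_sigma]
    exact Finset.sum_congr rfl fun i _ => ConjIndex.card_nontriv (Q i)
  rw [← h1, ← ConjIndex.card_nontriv K]
  refine Nat.card_le_card_of_injective
    (fun x => (⟨x.2.1, hle x.1 x.2.2.1, x.2.2.2⟩ : ConjIndex.Nontriv K)) ?_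
  rintro ⟨i, x⟩ ⟨j, y⟩ hxy
  have hval : x.1 = y.1 := congrArg Subtype.val hxy
  by_cases hij : i = j
  · subst hij
    obtain rfl : x = y := Subtype.ext hval
    rfl
  · exfalso
    have hmem : x.1 ∈ Q i ⊓ Q j := ⟨x.2.1, hval ▸ y.2.1⟩
    rw [hdisj i j hij, mem_bot] at hmem
    exact x.2.2 hmem

/-- In the signatures `(12; 2,3,3)` and `(24; 2,3,4)` there are exactly four Sylow
`3`-subgroups. [folklore] -/
theorem card_sylow_three_eq_four [Finite H] (h2 : HasTwoFixedPoints H X)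
    (h : Nat.card H = 12 ∨ Nat.card H = 24)
    (hallow : ∀ q : X, IsPole H q → 3 ∣ Nat.card (stabilizer H q) →
      Nat.card (stabilizer H q) = 3) :
    haveI : Fact (Nat.Prime 3) := ⟨Nat.prime_three⟩
    Nat.card (Sylow 3 H) = 4 := by
  haveI : Fact (Nat.Prime 3) := ⟨Nat.prime_three⟩
  obtain ⟨P⟩ : Nonempty (Sylow 3 H) := inferInstance
  have hP : Nat.card (P : Subgroup H) = 3 := by
    rcases h with h | h
    · have := card_sylow_of_card P 1 4 (by rw [h]; norm_num) (by norm_num)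
      simpa using this
    · have := card_sylow_of_card P 1 8 (by rw [h]; norm_num) (by norm_num)
      simpa using this
  have hmod : Nat.card (Sylow 3 H) ≡ 1 [MOD 3] := card_sylow_modEq_one 3 H
  have hdvd : Nat.card (Sylow 3 H) ∣ (P : Subgroup H).index := Sylow.card_dvd_index P
  have hidx : (P : Subgroup H).index * 3 = Nat.card H := by
    have := (P : Subgroup H).index_mul_card
    rwa [hP] at this
  have hnn : ¬ (P : Subgroup H).Normal :=
    not_normal_sylow h2 P hP hallow (by rcases h with h | h <;> omega)
  have hne1 : Nat.card (Sylow 3 H) ≠ 1 := by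
    intro h1
    apply hnn
    rw [← Subgroup.normalizer_eq_top_iff, ← Subgroup.index_eq_one]
    exact (Sylow.card_eq_index_normalizer P).symm.trans h1
  obtain ⟨s, hs⟩ : ∃ s, Nat.card (Sylow 3 H) = s := ⟨_, rfl⟩
  rw [hs] at hmod hdvd hne1 ⊢
  rcases h with h | h <;> rw [h] at hidx
  · have hi : (P : Subgroup H).index = 4 := by omega
    rw [hi] at hdvd
    have hs4 : s ≤ 4 := Nat.le_of_dvd (by norm_num) hdvd
    interval_cases s
    · exact absurd hdvd (by decide)
    · exact absurd rfl hne1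
    · exact absurd hmod (by decide)
    · exact absurd hdvd (by decide)
    · rfl
  · have hi : (P : Subgroup H).index = 8 := by omega
    rw [hi] at hdvd
    have hs8 : s ≤ 8 := Nat.le_of_dvd (by norm_num) hdvd
    interval_cases s
    · exact absurd hdvd (by decide)
    · exact absurd rfl hne1
    · exact absurd hmod (by decide)
    · exact absurd hdvd (by decide)
    · rfl
    · exact absurd hmod (by decide)
    · exact absurd hdvd (by decide)
    · exact absurd hdvd (by decide)
    · exact absurd hmod (by decide)

/-! ### Tetrahedral case -/

/-- **Signature `(12; 2,3,3)` forces `H ≅ A₄`**: the conjugation action on the four Sylow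
`3`-subgroups is faithful (its kernel lies in `N(P) = P` and is not `P`, which is not
normal) and `|H| = 12 = 4!/2`. [folklore] -/
theorem a4_of_signature [Finite H] (h2 : HasTwoFixedPoints H X) (h12 : Nat.card H = 12)
    (hst : ∀ q : X, IsPole H q →
      Nat.card (stabilizer H q) = 2 ∨ Nat.card (stabilizer H q) = 3) :
    Nonempty (H ≃* alternatingGroup (Fin 4)) := by
  haveI : Fact (Nat.Prime 3) := ⟨Nat.prime_three⟩
  have hallow : ∀ q : X, IsPole H q → 3 ∣ Nat.card (stabilizer H q) →
      Nat.card (stabilizer H q) = 3 := by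
    intro q hq h3
    rcases hst q hq with h | h
    · rw [h] at h3
      exact absurd h3 (by norm_num)
    · exact h
  have hn4 := card_sylow_three_eq_four h2 (Or.inl h12) hallow
  obtain ⟨P⟩ : Nonempty (Sylow 3 H) := inferInstance
  have hP : Nat.card (P : Subgroup H) = 3 := by
    have := card_sylow_of_card P 1 4 (by rw [h12]; norm_num) (by norm_num)
    simpa using this
  have hNcard : Nat.card (normalizer ((P : Subgroup H) : Set H)) = 3 := by
    have h1 : Nat.card (Sylow 3 H) = (normalizer ((P : Subgroup H) : Set H)).index :=
      Sylow.card_eq_index_normalizer P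
    have h3 := (normalizer ((P : Subgroup H) : Set H)).index_mul_card
    rw [← h1, hn4, h12] at h3
    omega
  have hNP : normalizer ((P : Subgroup H) : Set H) = P :=
    (eq_of_le_of_card_ge le_normalizer (by rw [hNcard, hP])).symm
  set K := (MulAction.toPermHom H (Sylow 3 H)).ker with hK
  have hKP : K ≤ (P : Subgroup H) := by
    intro k hk
    have := mem_normalizer_of_mem_ker hk P
    rwa [hNP] at this
  have hKbot : K = ⊥ := by
    by_contra hne
    have hK1 : 1 < Nat.card K := K.one_lt_card_iff_ne_bot.mpr hne
    have hK3 : Nat.card K ∣ 3 := hP ▸ card_dvd_of_le hKP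
    have hK3' : Nat.card K = 3 := by
      rcases (Nat.dvd_prime Nat.prime_three).mp hK3 with h | h
      · omega
      · exact h
    have hKeq : K = (P : Subgroup H) := eq_of_le_of_card_ge hKP (by rw [hK3', hP])
    have hn : (P : Subgroup H).Normal := by
      rw [← hKeq]
      infer_instance
    exact not_normal_sylow h2 P hP hallow (by rw [h12]; norm_num) hn
  have hinj : Function.Injective (MulAction.toPermHom H (Sylow 3 H)) :=
    (MonoidHom.ker_eq_bot_iff _).mp hKbot
  exact nonempty_mulEquiv_alternating_of_injective hn4 hinj (by rw [h12]; decide)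

/-! ### Octahedral case -/

/-- **Signature `(24; 2,3,4)` forces `H ≅ S₄`**: the conjugation action on the four Sylow
`3`-subgroups is faithful — its kernel `K ≤ N(P)` has order dividing `6`; `3 ∣ |K|` would put
all four Sylow `3`-subgroups inside `K` (too many elements), and `|K| = 2` would give a
central involution, whose fixed points would have a stabiliser of index `≤ 2` — and
`|H| = 24 = 4!`. [folklore] -/
theorem s4_of_signature [Finite H] (h2 : HasTwoFixedPoints H X) (h24 : Nat.card H = 24)
    (hst : ∀ q : X, IsPole H q → Nat.card (stabilizer H q) = 2 ∨
      Nat.card (stabilizer H q) = 3 ∨ Nat.card (stabilizer H q) = 4) :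
    Nonempty (H ≃* Equiv.Perm (Fin 4)) := by
  classical
  haveI : Fact (Nat.Prime 3) := ⟨Nat.prime_three⟩
  have hallow : ∀ q : X, IsPole H q → 3 ∣ Nat.card (stabilizer H q) →
      Nat.card (stabilizer H q) = 3 := by
    intro q hq h3
    rcases hst q hq with h | h | h
    · rw [h] at h3
      exact absurd h3 (by norm_num)
    · exact h
    · rw [h] at h3
      exact absurd h3 (by norm_num)
  have hn4 := card_sylow_three_eq_four h2 (Or.inr h24) hallow
  have hP3 : ∀ R : Sylow 3 H, Nat.card (R : Subgroup H) = 3 := fun R => by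
    have := card_sylow_of_card R 1 8 (by rw [h24]; norm_num) (by norm_num)
    simpa using this
  obtain ⟨P⟩ : Nonempty (Sylow 3 H) := inferInstance
  have hNcard : Nat.card (normalizer ((P : Subgroup H) : Set H)) = 6 := by
    have h1 : Nat.card (Sylow 3 H) = (normalizer ((P : Subgroup H) : Set H)).index :=
      Sylow.card_eq_index_normalizer P
    have h3 := (normalizer ((P : Subgroup H) : Set H)).index_mul_card
    rw [← h1, hn4, h24] at h3
    omega
  set K := (MulAction.toPermHom H (Sylow 3 H)).ker with hK
  haveI hKn : K.Normal := inferInstance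
  have hKN : K ≤ normalizer ((P : Subgroup H) : Set H) := fun k hk => mem_normalizer_of_mem_ker hk P
  have hK6 : Nat.card K ∣ 6 := hNcard ▸ card_dvd_of_le hKN
  -- `3 ∤ |K|`
  have hK3 : ¬ 3 ∣ Nat.card K := by
    intro h3
    obtain ⟨a, haK, ha⟩ := exists_mem_orderOf_eq h3
    have hza : Nat.card (zpowers a) = 3 := by rw [Nat.card_zpowers, ha]
    have hfac : (Nat.card H).factorization 3 = 1 :=
      factorization_eq_of_eq (a := 1) (m := 8) Nat.prime_three (by rw [h24]; norm_num)
        (by norm_num)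
    set Q₀ : Sylow 3 H := Sylow.ofCard (zpowers a) (by rw [hza, hfac, pow_one]) with hQ₀
    have hQ₀K : ((Q₀ : Sylow 3 H) : Subgroup H) ≤ K := by
      rw [hQ₀, Sylow.coe_ofCard]
      exact zpowers_le.mpr haK
    have hall : ∀ R : Sylow 3 H, (R : Subgroup H) ≤ K := by
      intro R
      obtain ⟨g, rfl⟩ := MulAction.exists_smul_eq H Q₀ R
      intro x hx
      have hx' : x ∈ ((g • Q₀ : Sylow 3 H) : Set H) := hx
      rw [Sylow.coe_smul, Set.mem_smul_set] at hx'
      obtain ⟨y, hy, rfl⟩ := hx'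
      rw [MulAut.smul_def, MulAut.conj_apply]
      exact hKn.conj_mem y (hQ₀K hy) g
    have hdisj : ∀ R R' : Sylow 3 H, R ≠ R' → (R : Subgroup H) ⊓ R' = ⊥ := fun R R' hne =>
      inf_eq_bot_of_prime_card Nat.prime_three (hP3 R) (hP3 R') (fun h => hne (Sylow.ext h))
    letI := Fintype.ofFinite (Sylow 3 H)
    have hsum := sum_card_sub_one_le (fun R : Sylow 3 H => (R : Subgroup H)) hdisj K hall
    simp only [hP3] at hsum
    rw [Finset.sum_const, Finset.card_univ, smul_eq_mul, ← Nat.card_eq_fintype_card, hn4]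
      at hsum
    have : Nat.card K ≤ 6 := Nat.le_of_dvd (by norm_num) hK6
    omega
  -- `|K| ≠ 2`
  have hK2 : Nat.card K ≠ 2 := by
    intro hK2
    obtain ⟨z, hzK, hz1⟩ : ∃ z ∈ K, z ≠ 1 := (K.bot_or_exists_ne_one).resolve_left (by
      intro h
      rw [h, card_bot] at hK2
      exact absurd hK2 (by norm_num))
    have hcentral : ∀ g : H, g * z * g⁻¹ = z := fun g =>
      eq_of_card_eq_two hK2 (hKn.conj_mem z hzK g) hzK
        (fun h => hz1 (by rwa [mul_inv_eq_one, mul_eq_left] at h)) hz1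
    obtain ⟨q, q', -, hF⟩ := h2 z hz1
    have hzq : z • q = q := by
      show q ∈ fixedBy X z
      rw [hF]
      exact Set.mem_insert _ _
    have hidx : (stabilizer H q).index ≤ 2 := index_stabilizer_le_two h2 hz1 (fun g => by
      have hg : z * g = g * z := by
        have := hcentral g
        calc z * g = g * z * g⁻¹ * g := by rw [this]
          _ = g * z := by group
      rw [← mul_smul, hg, mul_smul, hzq])
    have hq : IsPole H q := ⟨z, hz1, hzq⟩
    have hle4 : Nat.card (stabilizer H q) ≤ 4 := by
      rcases hst q hq with h | h | h <;> omega
    have h1 := (stabilizer H q).index_mul_card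
    rw [h24] at h1
    have := Nat.mul_le_mul hidx hle4
    omega
  have hK1 : Nat.card K = 1 := by
    obtain ⟨c, hc⟩ : ∃ c, Nat.card K = c := ⟨_, rfl⟩
    have hpos : 0 < Nat.card K := Nat.card_pos
    rw [hc] at hK6 hK3 hK2 hpos ⊢
    have h6 : c ≤ 6 := Nat.le_of_dvd (by norm_num) hK6
    interval_cases c <;> omega
  have hinj : Function.Injective (MulAction.toPermHom H (Sylow 3 H)) :=
    (MonoidHom.ker_eq_bot_iff _).mp (K.card_eq_one.mp hK1)
  exact nonempty_mulEquiv_perm_of_injective hn4 hinj (by rw [h24]; decide)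

/-! ### Icosahedral case -/

/-- **Signature `(60; 2,3,5)` forces `H ≅ A₅`**, via the faithful conjugation action on the
five Sylow `2`-subgroups.  Steps: a Sylow `2`-subgroup `P` (order `4`, abelian) is the full
centraliser of each of its non-identity elements (the centraliser permutes the two fixed
points, whose stabilisers have order `2`); hence `N(P)/P` embeds in `S_3` and `|N(P)| ∣ 24`,
so `|N(P)| ∈ {4, 12}`; `|N(P)| = 4` would give `15` Sylow `2`-subgroups and `45` distinct
non-identity `2`-elements, each determined by one of its (at most `30`) fixed points; so there
are `5` Sylow `2`-subgroups, and the kernel `K ≤ N(P)` of the action has order dividing `12`,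
contains no involution (an involution has `15` conjugates) and is not of order `3` (an element
of order `3` has centraliser of order `≤ 10`), so `K = 1`; finally `|H| = 60 = 5!/2`.
[folklore] -/
theorem a5_of_signature [Finite H] (h2 : HasTwoFixedPoints H X) (h60 : Nat.card H = 60)
    (hst : ∀ q : X, IsPole H q → Nat.card (stabilizer H q) = 2 ∨
      Nat.card (stabilizer H q) = 3 ∨ Nat.card (stabilizer H q) = 5)
    (horb : ∃ p₀ : X, ∀ q : X, Nat.card (stabilizer H q) = 2 → q ∈ orbit H p₀) :
    Nonempty (H ≃* alternatingGroup (Fin 5)) := by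
  classical
  haveI : Fact (Nat.Prime 2) := ⟨Nat.prime_two⟩
  have hP4 : ∀ P : Sylow 2 H, Nat.card (P : Subgroup H) = 4 := fun P =>
    card_sylow_of_card P 2 15 (by rw [h60]; norm_num) (by norm_num)
  have hPne : ∀ P : Sylow 2 H, ∃ z ∈ (P : Subgroup H), z ≠ 1 := fun P =>
    (bot_or_exists_ne_one _).resolve_left (by
      intro h
      have := hP4 P
      rw [h, card_bot] at this
      exact absurd this (by norm_num))
  -- fixed points of any element
  have hfix : ∀ z : H, z ≠ 1 → ∃ q : X, z • q = q := fun z hz => by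
    obtain ⟨q, q', -, hF⟩ := h2 z hz
    exact ⟨q, show q ∈ fixedBy X z by rw [hF]; exact Set.mem_insert _ _⟩
  -- (1) stabilisers of fixed points of non-identity `2`-elements have order `2`
  have hstab2 : ∀ (P : Sylow 2 H) (z : H), z ∈ (P : Subgroup H) → z ≠ 1 → ∀ q : X,
      z • q = q → Nat.card (stabilizer H q) = 2 := by
    intro P z hzP hz1 q hzq
    have hq : IsPole H q := ⟨z, hz1, hzq⟩
    have hdvd : orderOf z ∣ Nat.card (stabilizer H q) := orderOf_dvd_card_stabilizer hzq
    have ho4 : orderOf z ∣ 4 := by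
      rw [← hP4 P]
      have := orderOf_dvd_natCard (⟨z, hzP⟩ : (P : Subgroup H))
      rwa [Subgroup.orderOf_mk] at this
    have ho1 : orderOf z ≠ 1 := orderOf_eq_one_iff.not.mpr hz1
    obtain ⟨o, ho⟩ : ∃ o, orderOf z = o := ⟨_, rfl⟩
    rw [ho] at hdvd ho4 ho1
    have ho4' : o ≤ 4 := Nat.le_of_dvd (by norm_num) ho4
    interval_cases o
    · exact absurd ho4 (by decide)
    · exact absurd rfl ho1
    · rcases hst q hq with h | h | h <;> rw [h] at hdvd ⊢ <;> omega
    · exact absurd ho4 (by decide)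
    · rcases hst q hq with h | h | h <;> rw [h] at hdvd ⊢ <;> omega
  -- (2) the centraliser of a non-identity `2`-element is its Sylow subgroup
  have hCz : ∀ (P : Sylow 2 H) (z : H), z ∈ (P : Subgroup H) → z ≠ 1 →
      centralizer ({z} : Set H) = (P : Subgroup H) := by
    intro P z hzP hz1
    have hcomm : IsMulCommutative (P : Subgroup H) :=
      IsPGroup.isMulCommutative_of_card_eq_prime_sq (p := 2) (by rw [hP4 P]; norm_num)
    have hle : (P : Subgroup H) ≤ centralizer ({z} : Set H) := by
      intro x hx
      rw [mem_centralizer_iff]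
      intro m hm
      rw [Set.mem_singleton_iff] at hm
      subst hm
      have := hcomm.is_comm.comm (⟨m, hzP⟩ : (P : Subgroup H)) ⟨x, hx⟩
      exact congrArg Subtype.val this
    obtain ⟨q, hzq⟩ := hfix z hz1
    symm
    apply eq_of_le_of_card_ge hle
    calc Nat.card (centralizer ({z} : Set H)) ≤ 2 * Nat.card (stabilizer H q) :=
        card_centralizer_le h2 hz1 hzq
      _ = Nat.card (P : Subgroup H) := by rw [hstab2 P z hzP hz1 q hzq, hP4 P]
  obtain ⟨P⟩ : Nonempty (Sylow 2 H) := inferInstance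
  -- (3) `|N(P)| ∣ 24`
  set M := normalizer ((P : Subgroup H) : Set H) with hM
  have hMdvd : Nat.card M ∣ 24 := by
    obtain ⟨z, hzP, hz1⟩ := hPne P
    let P' : Subgroup M := (P : Subgroup H).subgroupOf M
    haveI hn : P'.Normal := Subgroup.normal_in_normalizer
    have hP'card : Nat.card P' = 4 := by
      rw [Nat.card_congr (subgroupOfEquivOfLe (le_normalizer : (P : Subgroup H) ≤ M)).toEquiv]
      exact hP4 P
    have hidx := ConjIndex.index_centralizer_dvd_factorial P'
    rw [hP'card, show (4 - 1 : ℕ).factorial = 6 by decide] at hidx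
    have hC : centralizer (P' : Set M) ≤ P' := by
      intro x hx
      rw [mem_subgroupOf]
      have hxz : (x : H) ∈ centralizer ({z} : Set H) := by
        rw [mem_centralizer_iff] at hx ⊢
        intro m hm
        rw [Set.mem_singleton_iff] at hm
        subst hm
        have hzM : m ∈ M := le_normalizer hzP
        have hmP' : (⟨m, hzM⟩ : M) ∈ (P' : Set M) := by
          show (⟨m, hzM⟩ : M) ∈ P'
          rw [mem_subgroupOf]
          exact hzP
        exact congrArg Subtype.val (hx ⟨m, hzM⟩ hmP')
      rw [hCz P z hzP hz1] at hxz
      exact hxz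
    have hCcard : Nat.card (centralizer (P' : Set M)) ∣ 4 := hP'card ▸ card_dvd_of_le hC
    rw [← (centralizer (P' : Set M)).card_mul_index]
    exact mul_dvd_mul hCcard hidx
  -- (4) `|N(P)| ∈ {4, 12}`
  have hn2 : Nat.card (Sylow 2 H) = M.index := Sylow.card_eq_index_normalizer P
  have hMi : M.index * Nat.card M = 60 := by rw [M.index_mul_card, h60]
  have h4M : 4 ∣ Nat.card M := hP4 P ▸ card_dvd_of_le le_normalizer
  have hM412 : Nat.card M = 4 ∨ Nat.card M = 12 := by
    obtain ⟨c, hc⟩ : ∃ c, Nat.card M = c := ⟨_, rfl⟩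
    rw [hc] at hMdvd h4M hMi ⊢
    have hc24 : c ≤ 24 := Nat.le_of_dvd (by norm_num) hMdvd
    interval_cases c <;> omega
  -- (5) `|N(P)| = 12`, by counting the fixed points of the `2`-elements
  have hM12 : Nat.card M = 12 := by
    rcases hM412 with h4 | h12
    · exfalso
      have hn15 : Nat.card (Sylow 2 H) = 15 := by
        rw [hn2]
        rw [h4] at hMi
        omega
      obtain ⟨p₀, hp₀⟩ := horb
      choose f hf using hfix
      have hDcard : Nat.card (Σ Q : Sylow 2 H, ConjIndex.Nontriv (Q : Subgroup H)) = 45 := by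
        letI := Fintype.ofFinite (Sylow 2 H)
        rw [Nat.card_sigma]
        simp only [ConjIndex.card_nontriv, hP4]
        rw [Finset.sum_const, Finset.card_univ, smul_eq_mul, ← Nat.card_eq_fintype_card, hn15]
      let F : (Σ Q : Sylow 2 H, ConjIndex.Nontriv (Q : Subgroup H)) → orbit H p₀ := fun d =>
        ⟨f d.2.1 d.2.2.2, hp₀ _ (hstab2 d.1 d.2.1 d.2.2.1 d.2.2.2 _ (hf d.2.1 d.2.2.2))⟩
      have hF : Function.Injective F := by
        rintro ⟨Q, x⟩ ⟨Q', y⟩ hxy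
        have hq : f x.1 x.2.2 = f y.1 y.2.2 := congrArg Subtype.val hxy
        have hx := hf x.1 x.2.2
        have hy := hf y.1 y.2.2
        rw [← hq] at hy
        have h2q : Nat.card (stabilizer H (f x.1 x.2.2)) = 2 := hstab2 Q x.1 x.2.1 x.2.2 _ hx
        have hxy1 : x.1 = y.1 := eq_of_card_eq_two h2q (mem_stabilizer_iff.mpr hx)
          (mem_stabilizer_iff.mpr hy) x.2.2 y.2.2
        have hQQ : Q = Q' := Sylow.ext (by
          rw [← hCz Q x.1 x.2.1 x.2.2, ← hCz Q' y.1 y.2.1 y.2.2, hxy1])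
        subst hQQ
        obtain rfl : x = y := Subtype.ext hxy1
        rfl
      have hOcard : Nat.card (orbit H p₀) ≤ 30 := by
        obtain ⟨z, hzP, hz1⟩ := hPne P
        have hq₀ : Nat.card (stabilizer H (f z hz1)) = 2 := hstab2 P z hzP hz1 _ (hf z hz1)
        have hmem := hp₀ _ hq₀
        have hp₀2 : Nat.card (stabilizer H p₀) = 2 := by
          rw [← card_stabilizer_eq_of_mem_orbit hmem, hq₀]
        rw [Nat.card_coe_set_eq, ← index_stabilizer]
        have := (stabilizer H p₀).index_mul_card
        rw [hp₀2, h60] at this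
        omega
      haveI : Finite (orbit H p₀) :=
        (Set.finite_range (fun g : H => g • p₀) : (orbit H p₀).Finite).to_subtype
      have := Nat.card_le_card_of_injective F hF
      rw [hDcard] at this
      omega
    · exact h12
  have hn5 : Nat.card (Sylow 2 H) = 5 := by
    rw [hn2]
    rw [hM12] at hMi
    omega
  -- (6) the kernel of the action is trivial
  set K := (MulAction.toPermHom H (Sylow 2 H)).ker with hK
  haveI hKn : K.Normal := inferInstance
  have hKM : K ≤ M := fun k hk => mem_normalizer_of_mem_ker hk P
  have hK12 : Nat.card K ∣ 12 := hM12 ▸ card_dvd_of_le hKM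
  have hKodd : ¬ 2 ∣ Nat.card K := by
    intro h2K
    obtain ⟨z, hzK, hz⟩ := exists_mem_orderOf_eq h2K
    have hz1 : z ≠ 1 := by
      intro h
      rw [h, orderOf_one] at hz
      exact absurd hz (by norm_num)
    have hzp : IsPGroup 2 (zpowers z) := IsPGroup.of_card (n := 1) (by
      rw [Nat.card_zpowers, hz, pow_one])
    obtain ⟨Q, hQ⟩ := hzp.exists_le_sylow
    have hzQ : z ∈ (Q : Subgroup H) := hQ (mem_zpowers z)
    have hidx : (centralizer ({z} : Set H)).index = 15 := by
      have hc4 : Nat.card (centralizer ({z} : Set H)) = 4 := by rw [hCz Q z hzQ hz1, hP4 Q]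
      have := (centralizer ({z} : Set H)).index_mul_card
      rw [hc4, h60] at this
      omega
    have hle := index_centralizer_le (S := (K : Set H)) (fun g => hKn.conj_mem z hzK g)
    rw [hidx, ncard_coe_subgroup] at hle
    have : Nat.card K ≤ 12 := Nat.le_of_dvd (by norm_num) hK12
    omega
  have hK3 : Nat.card K ≠ 3 := by
    intro hK3
    obtain ⟨a, haK, ha1⟩ : ∃ a ∈ K, a ≠ 1 := (K.bot_or_exists_ne_one).resolve_left (by
      intro h
      rw [h, card_bot] at hK3
      exact absurd hK3 (by norm_num))
    have hle := index_centralizer_le (S := (K : Set H) \ {1}) (fun g => ⟨hKn.conj_mem a haK g, by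
      rw [Set.mem_singleton_iff]
      intro h
      apply ha1
      rwa [mul_inv_eq_one, mul_eq_left] at h⟩)
    rw [Set.ncard_sdiff_singleton_of_mem (show (1 : H) ∈ (K : Set H) from K.one_mem),
      ncard_coe_subgroup, hK3] at hle
    obtain ⟨q, haq⟩ := hfix a ha1
    have hq : IsPole H q := ⟨a, ha1, haq⟩
    have hc := card_centralizer_le h2 ha1 haq
    have h5 : Nat.card (stabilizer H q) ≤ 5 := by
      rcases hst q hq with h | h | h <;> omega
    have h1 := (centralizer ({a} : Set H)).index_mul_card
    rw [h60] at h1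
    have := Nat.mul_le_mul hle (hc.trans (Nat.mul_le_mul_left 2 h5))
    omega
  have hK1 : Nat.card K = 1 := by
    obtain ⟨c, hc⟩ : ∃ c, Nat.card K = c := ⟨_, rfl⟩
    have hpos : 0 < Nat.card K := Nat.card_pos
    rw [hc] at hK12 hKodd hK3 hpos ⊢
    have : c ≤ 12 := Nat.le_of_dvd (by norm_num) hK12
    interval_cases c <;> omega
  have hinj : Function.Injective (MulAction.toPermHom H (Sylow 2 H)) :=
    (MonoidHom.ker_eq_bot_iff _).mp (K.card_eq_one.mp hK1)
  exact nonempty_mulEquiv_alternating_of_injective hn5 hinj (by rw [h60]; decide)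

/-! ### Assembly -/

/-- **Klein's classification from the two axioms.**  A finite group acting on a set so that
every non-identity element has exactly two fixed points and every stabiliser is cyclic is
cyclic, dihedral, or isomorphic to `A₄`, `S₄` or `A₅`. [folklore] -/
theorem klein_of_hasTwoFixedPoints [Finite H] (h2 : HasTwoFixedPoints H X)
    (hcyc : ∀ p : X, IsCyclic (stabilizer H p)) :
    IsCyclic H ∨ (∃ m : ℕ, Nonempty (H ≃* DihedralGroup m)) ∨
      Nonempty (H ≃* alternatingGroup (Fin 4)) ∨ Nonempty (H ≃* Equiv.Perm (Fin 4)) ∨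
        Nonempty (H ≃* alternatingGroup (Fin 5)) := by
  rcases signature h2 with h1 | ⟨p, hp⟩ | ⟨p, hp⟩ | ⟨h12, hst⟩ | ⟨h24, hst⟩ | ⟨h60, hst, horb⟩
  · left
    haveI : Subsingleton H := (Nat.card_eq_one_iff_unique.mp h1).1
    infer_instance
  · exact Or.inl (isCyclic_of_stabilizer_eq_top hcyc hp)
  · exact Or.inr (Or.inl (dihedral_of_index_two h2 hcyc hp))
  · exact Or.inr (Or.inr (Or.inl (a4_of_signature h2 h12 hst)))
  · exact Or.inr (Or.inr (Or.inr (Or.inl (s4_of_signature h2 h24 hst))))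
  · exact Or.inr (Or.inr (Or.inr (Or.inr (a5_of_signature h2 h60 hst horb))))

end Literature.NumberTheory.GaloisRepresentations.KleinAction
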